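/-
COR-CM (cell pub-hodgecm2, stage 2 of the Hodge ladder) — TRANSPOSITION SURGE, DICTIONARY ITEM (vi) of rfwf v3 §4.2 (tex
ll. 261–265), DISCHARGE FILE 1 of the item-(vi) prover `pub-hodgecm2-tr-prover-6` (rule (1) pre-ACK of the stage-2 lead,
HOME/INBOX l.3657, pattern `Transposition/Item6Holds*.lean`; CLAIM line HOME/INBOX l.3790).  Interface of record:
`Transposition/Item6SupplyAssembly.lean` (p272758).  ITEM6-SPLIT §(c): this file is sub-binder S3 (Prop 4.3 `Wedge` ⇐
translate-closure + B01-H) and the S6 SHAPE («supply ⇒ item (vi)», generic and on the universe of record, with the Albanese /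
type-reach normal forms of what is left), in the kernel; it does NOT touch S1/S2 (theta-model `Theta`/`Theta_sub`, NON-VANISHING
`supply`: own-htheta lineage).  Residual displayed binders after this file: SUPPLY (B01-S `Universe.FaceSupply`,
`B01/FaceInputsSplit.lean:50`, or its ∃ι₁ ∃V form) and, until p260689 `Model.heckeWedge10_holds` lands, the leaf B01-H
`Universe.HeckeWedge10` (:177) as `hW`.  Theorems, ONE smart constructor (`FaceThetaSupply.ofUiso`), ONE datum
(`HeckeFamily.univ`); no `def … : Prop`, no cite binder, nothing cited as a record, nothing asserted, no `sorry`.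
FRAMING (COORDINATOR RULING 2026-08-21T11:55:35Z): HC_CM is NOT proved; nobody has inhabited `FaceSupply U_rec`.
ERRATUM to `Item6SupplyAssembly.lean`:95–96 (CARRY-FORWARD ORDER of the stage-2 lead, HOME/INBOX l.3831 (2), red-team
AUDIT-CITESCOPE §1.4): the `supply` field is NOT attributed to [GR91 Prop 3.1.1] (a SPLITTING statement, Invent. Math. 105
p. 455 L1–3; non-vanishing is not in GR91 §3.1); its source is whatever AS-PRINTED binder the kernel discharge consumes (ruling
13:05:07Z), else it is reported `ITEM6 UNDISCHARGED:`.  THIS file consumes NO cite: `supply` enters only as a HYPOTHESIS.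
-/
import Summits.HodgeConjecture.CorCM.B01.Transposition.Item6SupplyAssembly
import Summits.HodgeConjecture.CorCM.B01.Transposition.Assembly
import Summits.HodgeConjecture.CorCM.B01.FaceInputsSplit
import Summits.HodgeConjecture.CorCM.B01.FaceSupplyAlbaneseHom
import Summits.HodgeConjecture.CorCM.UisoLevelMonotone
import HarnessLib

/-!
# Transposition item (vi): Prop 4.3 and the Thm 4.4 wiring are FREE for the saturated theta sets — item (vi) ⇔ supply

Stage-1 declarations generalised (PKG root `run/shared/lean/pub/pub-hodgecm/lean/HodgeCMPerL/HodgeCM/`):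
`Universe.HeckeData` (`Automorphic/HeckeWedge.lean:75`) ↦ `Transposition.HeckeFamily.univ`; `Open_heckeTheta`/`Fact_coverTheta`
(:110/:121) ↦ `FaceThetaSupply.translateClosed_ofUiso` (PROVED for the saturated sets, any Hecke family);
`exists_cup_ne_zero_of_hecke` (:146, PerL Prop 4.3 by the Hecke route) ↦ `FaceThetaSupply.wedge_ofUiso` /
`wedge_of_translateClosed_univ`; `thm44_of_realisation`'s realisation input (`StubTree/PerLProof.lean:142`) in the ∃(V₃,h) form
↦ `faceThetaSupplyWedgeExists_of_exists_supply` / `_of_faceSupply`.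

* §1 `HeckeFamily.univ U` (ALL morphisms `P_{Γ'} → P_Γ` of the towers): `heckeWedge10Within_univ_iff : HeckeWedge10Within U univ
  ↔ U.HeckeWedge10`; translate-closure under `univ` = closure under every pull-back, and implies closure under every family.
* §2 The SATURATED supply datum `FaceThetaSupply.ofUiso` — `Theta i Γ := U_{Ψ i}(Γ)_σ` itself (`Universe.Uiso`), `Theta_sub` by
  reflexivity, `supply` = a pair of non-zero classes of `U_{Ψ₀}(Γ)`, `U_{Ψ₁}(Γ)` at one level; translate-closed for EVERY Hecke
  family (`Universe.pullC_mem_Uiso`, `Fact_pull_comp` only), hence Prop 4.3 `Wedge` from B01-H (`wedge_ofUiso`; `Fact_pull_hodge`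
  for `U_Ψ ⊆ H^{1,0}`).  Per context this is the `S` the day-1 assembly consumes (`exists_faceThetaSupply_wedge_of_supply`); item
  (v)'s coupling for THESE sets is `IsolationSpans U emb S.Theta` at `Theta := Uiso` (the B01-O convention, `FaceInputsSplit.lean:101`).
* §3 Over any universe with `Fact_pull_comp`, `Fact_pull_hodge`, `HeckeWedge10`: `faceThetaSupplyWedgeExists_iff_exists_supply` —
  item (vi)'s typed axiom `FaceThetaSupplyWedgeExists U` (`Item6SupplyAssembly.lean:275`) ⇔ supply in the ∃ι₁ ∃V ∃Γ form (→ is the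
  interface's `exists_supply_witness`); `faceThetaSupplyWedgeExists_of_faceSupply` — the ∀-form B01-S implies it
  (`StubTree.admissible_exists`, `landherr_exists_proof`).
* §4 `U = Model.picardCMUniverse hHD hI h₁ h₃` (facts = `Model.universeOf_fact_pull_comp/hodge`; displayed: `hW : U.HeckeWedge10` =
  p260689, and SUPPLY): the ALBANESE normal form `faceThetaSupplyWedgeExists_iff_exists_hom_ne_zero` (row D0
  `picardCMUniverse_Uiso_ne_bot_iff_exists_hom_ne_zero`, `FaceSupplyAlbaneseHom.lean:112`) — modulo `hW`, item (vi) ⇔ «per Galois CM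
  `F` of degree `≥ 6` and face `f`, at SOME admissible `ι₁`, SOME `V`, SOME `Γ`: `Hom(Alb(P_Γ), A_{(F,ψ₀)}) ≠ 0 ∧ Hom(Alb(P_Γ),
  A_{(F,ψ₁)}) ≠ 0» (print shape of Murty–Ramakrishnan 1992 / [Liu 2021] Cor. 4.20 plus the non-vanishing S2); and the sharpest form
  `faceThetaSupplyWedgeExists_iff_exists_slotReach`: at one `(ι₁, V)` per face each slot variety is REACHED (a morphism non-zero on
  `H¹`) by SOME surface of the tower, levels independent (`CorCM/UisoLevelMonotone.lean`), no eigen-class, no isotypicity;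
  `faceThetaSupplyWedgeExists_rec_of_faceSupply` is the `_holds` instance.
* §5 The day-1 assembly FOR THE SATURATED SETS (`Universe.FaceThetaDataExists`, `Transposition/Assembly.lean:52`, via the interface's
  `exists_faceThetaDatum_of_items` :339): per field-and-face, supply at one admissible `(ι₁, V)` + item (iii)'s `L²` dictionary
  `(HG, emb, cover, emb_cover, inner_emb)` + item (v)'s `IsolationSpans U emb Θ` at `Θ := (U_{ψ i}(Γ)_{ι₁})` ⇒ `U.FaceThetaDataExists`
  (`Transposition.faceThetaDataExists_of_saturated_items`, any `U`; `Model.faceThetaDataExists_of_saturated_items` on `picardCMUniverse`,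
  binders `hW` and the joint ∃-statement ONLY; then `Model.hc_cm_closed_of_faceThetaDataExists` gives `HC_CM` at the universe of
  record) — the END-DISPLAY SHAPE of ITEM6-SPLIT S6 with the two cites replaced by what they are cited FOR (supply, isolation).
  HC_CM is NOT proved — nobody has inhabited the joint ∃-statement.
-/

noncomputable section

open scoped TensorProduct InnerProductSpace

namespace Summit.HodgeConjecture.CorCM

open Literature.AlgebraicGeometry.Motives (CMType HodgeStructure)
open Literature.AlgebraicGeometry.Motives.HodgeStructure (conj)
namespace Transposition

/-! ## §1  The Hecke family of all morphisms of the towers -/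

/-- **The Hecke family of ALL morphisms** `P_{Γ'} → P_Γ` of the towers — the largest `HeckeFamily`; on the model universe it
contains the level coverings (`B01/LevelCovering.lean:136`) and both projections of every Hecke pair (`B01/HeckePair.lean:252`). -/
def HeckeFamily.univ (U : Universe) : HeckeFamily U := ⟨fun _ _ => Set.univ⟩

/-- **B01-H within the family of all morphisms is the tree's forgetful leaf B01-H** `Universe.HeckeWedge10`
(`B01/FaceInputsSplit.lean:177`). [folklore] -/
theorem heckeWedge10Within_univ_iff (U : Universe) : HeckeWedge10Within U (HeckeFamily.univ U) ↔ U.HeckeWedge10 := by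
  refine ⟨heckeWedge10_of_within, fun h L ι₁ V Γ a a' ha ha' hne hne' => ?_⟩
  obtain ⟨Γ', g, h', hcup⟩ := h L ι₁ V Γ a a' ha ha' hne hne'
  exact ⟨Γ', g, Set.mem_univ _, h', Set.mem_univ _, hcup⟩

namespace FaceThetaSupply

variable {U : Universe} {L : CMField} {ι₁ : L →+* ℂ} {V : HermSpace3 L ι₁} {K : CMField} {Ψ : Fin 4 → CMType K}
  {σ : K →+* ℂ}

/-- Translate-closure under the family of all morphisms = closure of the theta sets under EVERY pull-back of the tower
(PKG `Open_heckeTheta` + `Fact_coverTheta`, `Automorphic/HeckeWedge.lean:110/121`, at once). [folklore] -/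
theorem translateClosed_univ_iff (S : FaceThetaSupply U ι₁ V K Ψ σ) :
    S.TranslateClosed (HeckeFamily.univ U) ↔
      ∀ (i : Fin 4) (Γ Γ' : Level V) (g : U.Mor (U.pms L ι₁ V Γ') (U.pms L ι₁ V Γ)),
        ∀ η ∈ S.Theta i Γ, U.pullC g 1 η ∈ S.Theta i Γ' :=
  ⟨fun h i Γ Γ' g η hη => h i Γ Γ' g (Set.mem_univ _) η hη, fun h i Γ Γ' g _ η hη => h i Γ Γ' g η hη⟩

/-- Translate-closure is antitone in the Hecke family. [folklore] -/
theorem TranslateClosed.anti {S : FaceThetaSupply U ι₁ V K Ψ σ} {Hk Hk' : HeckeFamily U}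
    (hle : ∀ {L : CMField} {ι₁ : L →+* ℂ} {V : HermSpace3 L ι₁} (Γ Γ' : Level V), Hk'.tr Γ Γ' ⊆ Hk.tr Γ Γ')
    (h : S.TranslateClosed Hk) : S.TranslateClosed Hk' :=
  fun i Γ Γ' g hg η hη => h i Γ Γ' g (hle Γ Γ' hg) η hη

/-- **Prop 4.3 by the Hecke route, forgetful form**: supply + closure of the theta sets under every pull-back of the tower
+ the tree's leaf B01-H `U.HeckeWedge10` ⇒ a non-zero theta (12)-wedge (`wedge_of_translateClosed` at `HeckeFamily.univ`). [folklore] -/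
theorem wedge_of_translateClosed_univ (S : FaceThetaSupply U ι₁ V K Ψ σ) (hH : U.Fact_pull_hodge)
    (hW : U.HeckeWedge10) (hT : S.TranslateClosed (HeckeFamily.univ U)) : S.Wedge :=
  S.wedge_of_translateClosed hH ((heckeWedge10Within_univ_iff U).2 hW) hT

/-! ## §2  The saturated supply datum: `Theta i Γ := U_{Ψ i}(Γ)_σ` -/

variable (U) in
/-- **The SATURATED supply datum** at a context `(L, ι₁, V; K, Ψ, σ)`: the theta set of type `Ψ i` at level `Γ` is the
whole isotypic space `U_{Ψ i}(Γ)_σ` (`Universe.Uiso`, `Geometry/Universe.lean:196`: the span of the pull-backs `F^*α` of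
holomorphic `σ`-eigen one-forms `α` on `A_{(K,Ψ i)}` along all morphisms `F : P_Γ → A_{(K,Ψ i)}`); `Theta_sub` is reflexivity
and `supply` is a pair of non-zero classes of `U_{Ψ₀}(Γ)`, `U_{Ψ₁}(Γ)` at one level (a B01-S witness, `FaceInputsSplit.lean:50`).
Generalises PKG `ThetaRealisation` (`Automorphic/Realisation.lean:102`) at its largest admissible `Theta`. [folklore] -/
def ofUiso (K : CMField) (Ψ : Fin 4 → CMType K) (σ : K →+* ℂ)
    (h : ∃ Γ : Level V, (∃ ω₀ ∈ U.Uiso Γ K (Ψ 0) σ, ω₀ ≠ 0) ∧ (∃ ω₁ ∈ U.Uiso Γ K (Ψ 1) σ, ω₁ ≠ 0)) :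
    FaceThetaSupply U ι₁ V K Ψ σ where
  Theta i Γ := U.Uiso Γ K (Ψ i) σ
  Theta_sub _ _ := subset_rfl
  supply := h

/-- **The saturated theta sets are translate-closed for EVERY Hecke family** (`U_Ψ(Γ)` is stable under pull-back along any
morphism of the tower: `Universe.pullC_mem_Uiso`, `B01/PeriodExpansion.lean:52`, from `Fact_pull_comp` alone) — the
transposition of PKG `Open_heckeTheta`/`Fact_coverTheta` costs nothing here. [folklore] -/
theorem translateClosed_ofUiso (hc : U.Fact_pull_comp) (K : CMField) (Ψ : Fin 4 → CMType K) (σ : K →+* ℂ)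
    (h : ∃ Γ : Level V, (∃ ω₀ ∈ U.Uiso Γ K (Ψ 0) σ, ω₀ ≠ 0) ∧ (∃ ω₁ ∈ U.Uiso Γ K (Ψ 1) σ, ω₁ ≠ 0))
    (Hk : HeckeFamily U) : (ofUiso U K Ψ σ h : FaceThetaSupply U ι₁ V K Ψ σ).TranslateClosed Hk :=
  fun i _ _ g _ _ hη => Universe.pullC_mem_Uiso hc g K (Ψ i) σ hη

/-- **Prop 4.3 for the saturated datum** (rfwf l. 263–264; PKG `Open_thetaWedge` `Automorphic/ThetaFacts.lean:187` /
`exists_cup_ne_zero_of_hecke` `Automorphic/HeckeWedge.lean:146`): supply + B01-H ⇒ a non-zero (12)-wedge of classes of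
`U_{Ψ₀}(Γ')`, `U_{Ψ₁}(Γ')` at some level.  Inputs: `Fact_pull_comp` (translate-closure), `Fact_pull_hodge` (`U_Ψ ⊆ H^{1,0}`),
the leaf `U.HeckeWedge10`. [folklore] -/
theorem wedge_ofUiso (hc : U.Fact_pull_comp) (hH : U.Fact_pull_hodge) (hW : U.HeckeWedge10) (K : CMField)
    (Ψ : Fin 4 → CMType K) (σ : K →+* ℂ)
    (h : ∃ Γ : Level V, (∃ ω₀ ∈ U.Uiso Γ K (Ψ 0) σ, ω₀ ≠ 0) ∧ (∃ ω₁ ∈ U.Uiso Γ K (Ψ 1) σ, ω₁ ≠ 0)) :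
    (ofUiso U K Ψ σ h : FaceThetaSupply U ι₁ V K Ψ σ).Wedge :=
  (ofUiso U K Ψ σ h).wedge_of_translateClosed hH ((heckeWedge10Within_univ_iff U).2 hW)
    (translateClosed_ofUiso hc K Ψ σ h _)

end FaceThetaSupply

/-- **Per context, the `S` the day-1 assembly consumes**: at any `(L, ι₁, V; K, Ψ, σ)` carrying a supply witness there is a
supply datum satisfying Prop 4.3 whose theta sets ARE the isotypic spaces `U_{Ψ i}(Γ)_σ` (so that item (v)'s coupling for
it is the coupling for `Uiso`-classes, the B01-O convention).  Binders: `Fact_pull_comp`, `Fact_pull_hodge`, `HeckeWedge10`. [folklore] -/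
theorem exists_faceThetaSupply_wedge_of_supply {U : Universe} (hc : U.Fact_pull_comp) (hH : U.Fact_pull_hodge)
    (hW : U.HeckeWedge10) {L : CMField} {ι₁ : L →+* ℂ} {V : HermSpace3 L ι₁} (K : CMField) (Ψ : Fin 4 → CMType K)
    (σ : K →+* ℂ) (h : ∃ Γ : Level V, (∃ ω₀ ∈ U.Uiso Γ K (Ψ 0) σ, ω₀ ≠ 0) ∧ (∃ ω₁ ∈ U.Uiso Γ K (Ψ 1) σ, ω₁ ≠ 0)) :
    ∃ S : FaceThetaSupply U ι₁ V K Ψ σ, S.Wedge ∧ ∀ (i : Fin 4) (Γ : Level V), S.Theta i Γ = U.Uiso Γ K (Ψ i) σ :=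
  ⟨FaceThetaSupply.ofUiso U K Ψ σ h, FaceThetaSupply.wedge_ofUiso hc hH hW K Ψ σ h, fun _ _ => rfl⟩

/-! ## §3  Closed forms: item (vi) ⇔ supply (∃ι₁ ∃V ∃Γ); B01-S (∀ι₁ ∀V) ⇒ item (vi) -/

/-- **Supply in the ∃ι₁ ∃V ∃Γ form implies item (vi)** (`FaceThetaSupplyWedgeExists U`, `Item6SupplyAssembly.lean:275`): take the
saturated datum at the witness.  Binders: `Fact_pull_comp`, `Fact_pull_hodge`, the leaf `U.HeckeWedge10`. [folklore] -/
theorem faceThetaSupplyWedgeExists_of_exists_supply {U : Universe} (hc : U.Fact_pull_comp) (hH : U.Fact_pull_hodge)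
    (hW : U.HeckeWedge10)
    (h : ∀ (F : CMField), IsGalois ℚ F → 6 ≤ Module.finrank ℚ F → ∀ f : Face F,
      ∃ ι₁ : F →+* ℂ, f.Admissible ι₁ ∧ ∃ (V : HermSpace3 F ι₁) (Γ : Level V) (ω₀ ω₁ : U.CohC (U.pms F ι₁ V Γ) 1),
        ω₀ ∈ U.Uiso Γ F (f.psi 0) ι₁ ∧ ω₁ ∈ U.Uiso Γ F (f.psi 1) ι₁ ∧ ω₀ ≠ 0 ∧ ω₁ ≠ 0) :
    FaceThetaSupplyWedgeExists U := by
  intro F hG h6 f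
  obtain ⟨ι₁, hι, V, Γ, ω₀, ω₁, h₀, h₁, hne₀, hne₁⟩ := h F hG h6 f
  exact ⟨ι₁, hι, V, FaceThetaSupply.ofUiso U F f.psi ι₁ ⟨Γ, ⟨ω₀, h₀, hne₀⟩, ⟨ω₁, h₁, hne₁⟩⟩,
    FaceThetaSupply.wedge_ofUiso hc hH hW F f.psi ι₁ _⟩

/-- **Item (vi) ⇔ supply (∃ form).**  Over any universe with `Fact_pull_comp`, `Fact_pull_hodge` and the leaf B01-H, the typed
axiom `FaceThetaSupplyWedgeExists U` of item (vi) is EQUIVALENT to the ∃ι₁ ∃V ∃Γ form of B01-S: per Galois CM field of degree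
`≥ 6` and face, at some admissible `ι₁`, some `V` and some level, a non-zero class of `U_{ψ₀}(Γ)` and a non-zero class of
`U_{ψ₁}(Γ)` (→: `exists_supply_witness`, :291; ←: the saturated datum).  So Prop 4.3, translate-closure and the Thm 4.4
wiring cost nothing: what item (vi) asks beyond tree theorems is the NON-VANISHING (S2). [folklore] -/
theorem faceThetaSupplyWedgeExists_iff_exists_supply {U : Universe} (hc : U.Fact_pull_comp) (hH : U.Fact_pull_hodge)
    (hW : U.HeckeWedge10) :
    FaceThetaSupplyWedgeExists U ↔
      ∀ (F : CMField), IsGalois ℚ F → 6 ≤ Module.finrank ℚ F → ∀ f : Face F,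
        ∃ ι₁ : F →+* ℂ, f.Admissible ι₁ ∧ ∃ (V : HermSpace3 F ι₁) (Γ : Level V) (ω₀ ω₁ : U.CohC (U.pms F ι₁ V Γ) 1),
          ω₀ ∈ U.Uiso Γ F (f.psi 0) ι₁ ∧ ω₁ ∈ U.Uiso Γ F (f.psi 1) ι₁ ∧ ω₀ ≠ 0 ∧ ω₁ ≠ 0 :=
  ⟨exists_supply_witness, faceThetaSupplyWedgeExists_of_exists_supply hc hH hW⟩

/-- **B01-S (the ∀ι₁ ∀V leaf `Universe.FaceSupply`, `FaceInputsSplit.lean:50`) implies item (vi)**: pick one admissible `ι₁`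
per face (`StubTree.admissible_exists`, rfwf Lemma 2.1) and one hermitian 3-space (`landherr_exists_proof`, Landherr), then
the saturated datum at the supplied level.  Binders: `Fact_pull_comp`, `Fact_pull_hodge`, `HeckeWedge10`, `FaceSupply`. [folklore] -/
theorem faceThetaSupplyWedgeExists_of_faceSupply {U : Universe} (hc : U.Fact_pull_comp) (hH : U.Fact_pull_hodge)
    (hW : U.HeckeWedge10) (hS : U.FaceSupply) : FaceThetaSupplyWedgeExists U := by
  refine faceThetaSupplyWedgeExists_of_exists_supply hc hH hW fun F hG h6 f => ?_
  obtain ⟨ι₁, hι⟩ := StubTree.admissible_exists F h6 f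
  obtain ⟨V⟩ := landherr_exists_proof F ι₁
  obtain ⟨Γ, ω₀, ω₁, h₀, h₁, hne₀, hne₁⟩ := hS F hG h6 f ι₁ hι V
  exact ⟨ι₁, hι, V, Γ, ω₀, ω₁, h₀, h₁, hne₀, hne₁⟩

/-! ## §5  The day-1 assembly for the saturated theta sets -/

/-- **`FaceThetaDataExists` from supply + the `L²` dictionary + isolation, for the SATURATED theta sets.**  Per Galois CM field
`F` of degree `≥ 6` and face `f`, at ONE admissible `ι₁` and ONE `V` (∃ outside the conjunction, RE-POINT (1)): a supply witness
(non-zero classes of `U_{ψ₀}(Γ)`, `U_{ψ₁}(Γ)` at one level — item (vi) S2), item (iii)'s `(HG, emb, cover, emb_cover, inner_emb)`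
and item (v)'s `IsolationSpans U emb Θ` (`Item5IsolationSpans.lean:117`; written out here as the socket field `coupling`, its body
verbatim, so that this file does not wait for that module's olean) for `Θ i Γ := U_{ψ i}(Γ)_{ι₁}` give a face theta datum
(the interface's `exists_faceThetaDatum_of_items`, :339, at `S := FaceThetaSupply.ofUiso`, whose `Wedge` is `wedge_ofUiso`).
Binders: `Fact_pull_comp`, `Fact_pull_hodge`, `Fact_cup2_hodge`, Hodge–Riemann (2,0) on the towers, the leaf `HeckeWedge10`,
and the joint ∃-statement. [folklore] -/
theorem faceThetaDataExists_of_saturated_items {U : Universe} (hc : U.Fact_pull_comp) (hH : U.Fact_pull_hodge)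
    (hcup2 : U.Fact_cup2_hodge) (hW : U.HeckeWedge10)
    (hHR : ∀ {L : CMField} {ι₁ : L →+* ℂ} {V : HermSpace3 L ι₁} (Γ : Level V) (η : U.CohC (U.pms L ι₁ V Γ) 2),
      η ∈ (U.hodge (U.pms L ι₁ V Γ) 2).F 2 → η ≠ 0 → U.trC (U.pms L ι₁ V Γ) 4 (U.cup2C (U.pms L ι₁ V Γ) 2 η (conj η)) ≠ 0)
    (h : ∀ (F : CMField), IsGalois ℚ F → 6 ≤ Module.finrank ℚ F → ∀ f : Face F,
      ∃ ι₁ : F →+* ℂ, f.Admissible ι₁ ∧ ∃ (V : HermSpace3 F ι₁),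
        (∃ (Γ : Level V) (ω₀ ω₁ : U.CohC (U.pms F ι₁ V Γ) 1),
          ω₀ ∈ U.Uiso Γ F (f.psi 0) ι₁ ∧ ω₁ ∈ U.Uiso Γ F (f.psi 1) ι₁ ∧ ω₀ ≠ 0 ∧ ω₁ ≠ 0) ∧
        ∃ (HG : Type) (_ : NormedAddCommGroup HG) (_ : InnerProductSpace ℂ HG)
          (emb : ∀ Γ : Level V, U.CohC (U.pms F ι₁ V Γ) 2 →ₗ[ℂ] HG)
          (cover : ∀ (Γ Γ' : Level V), Γ' ≤ Γ → U.Mor (U.pms F ι₁ V Γ') (U.pms F ι₁ V Γ)),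
          (∀ (Γ : Level V) (ω₁ ω₂ : U.CohC (U.pms F ι₁ V Γ) 1), ω₁ ∈ U.Uiso Γ F (f.psi 0) ι₁ → ω₂ ∈ U.Uiso Γ F (f.psi 1) ι₁ →
            emb Γ (U.cup2C (U.pms F ι₁ V Γ) 1 ω₁ ω₂) ∈ (Submodule.span ℂ
              {x : HG | ∃ (Γ' : Level V), ∃ ω₃ ∈ U.Uiso Γ' F (f.psi 2) ι₁, ∃ ω₄ ∈ U.Uiso Γ' F (f.psi 3) ι₁,
                x = emb Γ' (U.cup2C (U.pms F ι₁ V Γ') 1 ω₃ ω₄)}).topologicalClosure) ∧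
          (∀ (Γ Γ' : Level V) (hle : Γ' ≤ Γ) (x : U.CohC (U.pms F ι₁ V Γ) 2),
            emb Γ' (U.pullC (cover Γ Γ' hle) 2 x) = emb Γ x) ∧
          (∀ Γ : Level V, ∃ c : ℂ, c ≠ 0 ∧ ∀ x y : U.CohC (U.pms F ι₁ V Γ) 2,
            x ∈ (U.hodge (U.pms F ι₁ V Γ) 2).F 2 → y ∈ (U.hodge (U.pms F ι₁ V Γ) 2).F 2 →
              ⟪emb Γ y, emb Γ x⟫_ℂ = c * U.trC (U.pms F ι₁ V Γ) 4 (U.cup2C (U.pms F ι₁ V Γ) 2 x (conj y)))) :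
    U.FaceThetaDataExists := by
  refine exists_faceThetaDatum_of_items hH hcup2 hHR fun F hG h6 f => ?_
  obtain ⟨ι₁, hι, V, ⟨Γ, ω₀, ω₁, h₀, h₁, hne₀, hne₁⟩, HG, _, _, emb, cover, hiso, hcov, hinner⟩ := h F hG h6 f
  exact ⟨ι₁, hι, V, FaceThetaSupply.ofUiso U F f.psi ι₁ ⟨Γ, ⟨ω₀, h₀, hne₀⟩, ⟨ω₁, h₁, hne₁⟩⟩, HG, _, _, emb, cover,
    FaceThetaSupply.wedge_ofUiso hc hH hW F f.psi ι₁ _, hiso, hcov, hinner⟩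

end Transposition

/-! ## §4  The universe of record -/

namespace Model

open CategoryTheory
open Literature.NumberTheory.Automorphic
open Literature.NumberTheory.Automorphic.PicardCM
open Literature.AlgebraicGeometry.HodgeTheory
open Literature.AlgebraicGeometry.Motives (Jacobian nonempty_jacobian_of_isSmoothProjective_complex_of_dim)

/-- **Item (vi) on a model universe from B01-S**, the two facts being tree theorems (`universeOf_fact_pull_comp`,
`universeOf_fact_pull_hodge`); displayed binders: the leaf B01-H `hW` (p260689 `Model.heckeWedge10_holds` discharges it by
name once in the tree) and B01-S `hS`. [folklore] -/
theorem faceThetaSupplyWedgeExists_of_faceSupply (hHD : exists_isReal_hodgeModel) (hI : hodgePQ_independent_of_hodgeModel)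
    (h₁ : BallQuotientUniformised) (h₃ : CMAbelianVarietyRealised) 
    (hW : (picardCMUniverse hHD hI h₁ h₃).HeckeWedge10)
    (hS : (picardCMUniverse hHD hI h₁ h₃).FaceSupply) :
    Transposition.FaceThetaSupplyWedgeExists (picardCMUniverse hHD hI h₁ h₃) :=
  Transposition.faceThetaSupplyWedgeExists_of_faceSupply
    (universeOf_fact_pull_comp hHD hI (ballQuotientUniformisedDatum_of h₁) h₃)
    (universeOf_fact_pull_hodge hHD hI (ballQuotientUniformisedDatum_of h₁) h₃) hW hS

/-- **Item (vi) on a model universe ⇔ supply (∃ι₁ ∃V ∃Γ)**, modulo the leaf B01-H. [folklore] -/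
theorem faceThetaSupplyWedgeExists_iff_exists_supply (hHD : exists_isReal_hodgeModel) (hI : hodgePQ_independent_of_hodgeModel)
    (h₁ : BallQuotientUniformised) (h₃ : CMAbelianVarietyRealised) 
    (hW : (picardCMUniverse hHD hI h₁ h₃).HeckeWedge10) :
    Transposition.FaceThetaSupplyWedgeExists (picardCMUniverse hHD hI h₁ h₃) ↔
      ∀ (F : CMField), IsGalois ℚ F → 6 ≤ Module.finrank ℚ F → ∀ f : Face F,
        ∃ ι₁ : F →+* ℂ, f.Admissible ι₁ ∧ ∃ (V : HermSpace3 F ι₁) (Γ : Level V)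
          (ω₀ ω₁ : (picardCMUniverse hHD hI h₁ h₃).CohC ((picardCMUniverse hHD hI h₁ h₃).pms F ι₁ V Γ) 1),
          ω₀ ∈ (picardCMUniverse hHD hI h₁ h₃).Uiso Γ F (f.psi 0) ι₁ ∧
            ω₁ ∈ (picardCMUniverse hHD hI h₁ h₃).Uiso Γ F (f.psi 1) ι₁ ∧ ω₀ ≠ 0 ∧ ω₁ ≠ 0 :=
  Transposition.faceThetaSupplyWedgeExists_iff_exists_supply
    (universeOf_fact_pull_comp hHD hI (ballQuotientUniformisedDatum_of h₁) h₃)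
    (universeOf_fact_pull_hodge hHD hI (ballQuotientUniformisedDatum_of h₁) h₃) hW

/-- **The ALBANESE normal form of what item (vi) still asks on a model universe** (modulo the leaf B01-H): for every Galois CM
field `F` of degree `≥ 6` and every face `f`, at SOME admissible `ι₁`, SOME hermitian 3-space `V` and SOME level `Γ`, and for
some (equivalently any, `Jacobian.uniqueUpToIso`) Albanese datum `𝒥` of the realised Picard modular surface `P_Γ`, there are
NON-ZERO homomorphisms `Alb(P_Γ) → A_{(F,ψ₀)}` and `Alb(P_Γ) → A_{(F,ψ₁)}` (row D0 `picardCMUniverse_Uiso_ne_bot_iff_exists_hom_ne_zero`,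
`FaceSupplyAlbaneseHom.lean:112`, at `σ = ι₁ ∈ ψᵢ` by `admissible_mem_psi`).  In print: the CM abelian varieties of the two slot
types are isogeny factors of `Alb(P_Γ)` at deep level (Murty–Ramakrishnan 1992; [Liu 2021] Cor. 4.20 `A_K ∼ ∏ A_μ^{d(μ,K)}` with
`d(μ,K) ≠ 0`) — sub-binder S2 of ITEM6-SPLIT, not proved here. [folklore] -/
theorem faceThetaSupplyWedgeExists_iff_exists_hom_ne_zero (hHD : exists_isReal_hodgeModel) (hI : hodgePQ_independent_of_hodgeModel)
    (h₁ : BallQuotientUniformised) (h₃ : CMAbelianVarietyRealised) 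
    (hW : (picardCMUniverse hHD hI h₁ h₃).HeckeWedge10) :
    Transposition.FaceThetaSupplyWedgeExists (picardCMUniverse hHD hI h₁ h₃) ↔
      ∀ (F : CMField), IsGalois ℚ F → 6 ≤ Module.finrank ℚ F → ∀ f : Face F,
        ∃ ι₁ : F →+* ℂ, f.Admissible ι₁ ∧ ∃ (V : HermSpace3 F ι₁) (Γ : Level V)
          (𝒥 : Jacobian (Var.scheme (ballQuotientUniformisedDatum_of h₁) h₃ (.pms (pmsCode F ι₁ V Γ))))
          (u₀ : 𝒥.J ⟶ (cmRealisation h₃ (cmCode F (f.psi 0))).AV)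
          (u₁ : 𝒥.J ⟶ (cmRealisation h₃ (cmCode F (f.psi 1))).AV), u₀ ≠ 0 ∧ u₁ ≠ 0 := by
  rw [faceThetaSupplyWedgeExists_iff_exists_supply hHD hI h₁ h₃ hW]
  refine forall_congr' fun F => forall_congr' fun hG => forall_congr' fun h6 => forall_congr' fun f =>
    exists_congr fun ι₁ => and_congr_right fun hι => exists_congr fun V => exists_congr fun Γ => ?_
  have hX := Var.isSmoothProjective (ballQuotientUniformisedDatum_of h₁) h₃ (.pms (pmsCode F ι₁ V Γ))
  constructor
  · rintro ⟨ω₀, ω₁, h₀, h₁', hne₀, hne₁⟩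
    obtain ⟨𝒥⟩ := nonempty_jacobian_of_isSmoothProjective_complex_of_dim _ hX
    obtain ⟨u₀, hu₀⟩ := (picardCMUniverse_Uiso_ne_bot_iff_exists_hom_ne_zero Γ F (f.psi 0)
      (admissible_mem_psi f ι₁ hι 0) 𝒥).1 (Submodule.ne_bot_iff _ |>.2 ⟨ω₀, h₀, hne₀⟩)
    obtain ⟨u₁, hu₁⟩ := (picardCMUniverse_Uiso_ne_bot_iff_exists_hom_ne_zero Γ F (f.psi 1)
      (admissible_mem_psi f ι₁ hι 1) 𝒥).1 (Submodule.ne_bot_iff _ |>.2 ⟨ω₁, h₁', hne₁⟩)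
    exact ⟨𝒥, u₀, u₁, hu₀, hu₁⟩
  · rintro ⟨𝒥, u₀, u₁, hu₀, hu₁⟩
    obtain ⟨ω₀, h₀, hne₀⟩ := (Submodule.ne_bot_iff _).1 ((picardCMUniverse_Uiso_ne_bot_iff_exists_hom_ne_zero Γ F
      (f.psi 0) (admissible_mem_psi f ι₁ hι 0) 𝒥).2 ⟨u₀, hu₀⟩)
    obtain ⟨ω₁, h₁', hne₁⟩ := (Submodule.ne_bot_iff _).1 ((picardCMUniverse_Uiso_ne_bot_iff_exists_hom_ne_zero Γ F
      (f.psi 1) (admissible_mem_psi f ι₁ hι 1) 𝒥).2 ⟨u₁, hu₁⟩)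
    exact ⟨ω₀, ω₁, h₀, h₁', hne₀, hne₁⟩

/-- **The sharpest residual of item (vi) on a model universe** (modulo the leaf B01-H): per Galois CM field `F` of degree
`≥ 6` and face `f`, at ONE admissible `ι₁` and ONE `V`, each of the two slot varieties `A_{(F,ψ₀)}`, `A_{(F,ψ₁)}` is REACHED —
a morphism `P_Γ → A_{(F,ψᵢ)}` non-zero on `H¹(−, ℚ)` — by SOME surface of the `V`-tower, the two levels INDEPENDENT (joined at
`Γ₀ ⊓ Γ₁` by the level-monotonicity of supply, `Model.exists_mem_uiso_ne_zero_of_le_of_two_lt`, `CorCM/UisoLevelMonotone.lean`),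
no eigen-class and no isotypicity left (row D0 `Universe.Uiso_ne_bot_iff` over the model rows `Fact_H1_rank`/`Fact_eigenLine`/
`Fact_alphaLine` of `picardCMUniverse_modelAxioms`).  This is B01-S's face-free «type reach» (`CorCM/FaceSupplyTypewise.lean`)
with `∀ ι₁ ∀ V` weakened to `∃ ι₁ ∃ V` shared by the two slot types. [folklore] -/
theorem faceThetaSupplyWedgeExists_iff_exists_slotReach (hHD : exists_isReal_hodgeModel) (hI : hodgePQ_independent_of_hodgeModel)
    (h₁ : BallQuotientUniformised) (h₃ : CMAbelianVarietyRealised) 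
    (hW : (picardCMUniverse hHD hI h₁ h₃).HeckeWedge10) :
    Transposition.FaceThetaSupplyWedgeExists (picardCMUniverse hHD hI h₁ h₃) ↔
      ∀ (F : CMField), IsGalois ℚ F → 6 ≤ Module.finrank ℚ F → ∀ f : Face F,
        ∃ ι₁ : F →+* ℂ, f.Admissible ι₁ ∧ ∃ (V : HermSpace3 F ι₁),
          (∃ (Γ : Level V) (u : (picardCMUniverse hHD hI h₁ h₃).Mor ((picardCMUniverse hHD hI h₁ h₃).pms F ι₁ V Γ)
              ((picardCMUniverse hHD hI h₁ h₃).cmAV F (f.psi 0))), (picardCMUniverse hHD hI h₁ h₃).pull u 1 ≠ 0) ∧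
          (∃ (Γ : Level V) (u : (picardCMUniverse hHD hI h₁ h₃).Mor ((picardCMUniverse hHD hI h₁ h₃).pms F ι₁ V Γ)
              ((picardCMUniverse hHD hI h₁ h₃).cmAV F (f.psi 1))), (picardCMUniverse hHD hI h₁ h₃).pull u 1 ≠ 0) := by
  have hD0 := fun {L : CMField} {ι₁ : L →+* ℂ} {V : HermSpace3 L ι₁} (Γ : Level V) (K : CMField) (Ψ : CMType K)
    {σ : K →+* ℂ} (hσ : σ ∈ Ψ.1) =>
    Universe.Uiso_ne_bot_iff (picardCMUniverse_modelAxioms hHD hI h₁ h₃).H1_rank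
      (picardCMUniverse_modelAxioms hHD hI h₁ h₃).eigenLine (picardCMUniverse_modelAxioms hHD hI h₁ h₃).alphaLine Γ K Ψ hσ
  rw [faceThetaSupplyWedgeExists_iff_exists_supply hHD hI h₁ h₃ hW]
  refine forall_congr' fun F => forall_congr' fun hG => forall_congr' fun h6 => forall_congr' fun f =>
    exists_congr fun ι₁ => and_congr_right fun hι => exists_congr fun V => ?_
  constructor
  · rintro ⟨Γ, ω₀, ω₁, h₀, h₁', hne₀, hne₁⟩
    exact ⟨⟨Γ, (hD0 Γ F (f.psi 0) (admissible_mem_psi f ι₁ hι 0)).1 ((Submodule.ne_bot_iff _).2 ⟨ω₀, h₀, hne₀⟩)⟩,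
      ⟨Γ, (hD0 Γ F (f.psi 1) (admissible_mem_psi f ι₁ hι 1)).1 ((Submodule.ne_bot_iff _).2 ⟨ω₁, h₁', hne₁⟩)⟩⟩
  · rintro ⟨⟨Γ₀, u₀, hu₀⟩, ⟨Γ₁, u₁, hu₁⟩⟩
    have hF : 2 < Module.finrank ℚ F := by omega
    obtain ⟨η₀, hη₀, hη₀ne⟩ := exists_mem_uiso_ne_zero_of_le_of_two_lt hHD hI h₁ h₃ hF (Γ := Γ₀) (Γ' := Γ₀ ⊓ Γ₁)
      (by rw [Level.inf_Γ]; exact inf_le_left)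
      ((Submodule.ne_bot_iff _).1 ((hD0 Γ₀ F (f.psi 0) (admissible_mem_psi f ι₁ hι 0)).2 ⟨u₀, hu₀⟩))
    obtain ⟨η₁, hη₁, hη₁ne⟩ := exists_mem_uiso_ne_zero_of_le_of_two_lt hHD hI h₁ h₃ hF (Γ := Γ₁) (Γ' := Γ₀ ⊓ Γ₁)
      (by rw [Level.inf_Γ]; exact inf_le_right)
      ((Submodule.ne_bot_iff _).1 ((hD0 Γ₁ F (f.psi 1) (admissible_mem_psi f ι₁ hι 1)).2 ⟨u₁, hu₁⟩))
    exact ⟨Γ₀ ⊓ Γ₁, η₀, η₁, hη₀, hη₁, hη₀ne, hη₁ne⟩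

/-- **The closed instance on THE universe of record** `U_rec` (all four universe parameters at their tree theorems
`exists_isReal_hodgeModel_holds`, `hodgePQ_independent_of_hodgeModel_holds`, `BallQuotient.ballQuotientUniformised_holds`,
`cmAbelianVarietyRealised_holds`): item (vi)'s typed axiom from the leaf B01-H and B01-S.  The `HC_CM` display for the saturated
sets is `Model.hc_cm_closed_of_faceThetaDataExists` (`Transposition/Assembly.lean:85`) ∘ `faceThetaDataExists_of_saturated_items`
at this instance.  HC_CM is NOT proved: nobody has inhabited `hS`. [folklore] -/
theorem faceThetaSupplyWedgeExists_rec_of_faceSupply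
    (hW : (picardCMUniverse exists_isReal_hodgeModel_holds hodgePQ_independent_of_hodgeModel_holds
      BallQuotient.ballQuotientUniformised_holds cmAbelianVarietyRealised_holds).HeckeWedge10)
    (hS : (picardCMUniverse exists_isReal_hodgeModel_holds hodgePQ_independent_of_hodgeModel_holds
      BallQuotient.ballQuotientUniformised_holds cmAbelianVarietyRealised_holds).FaceSupply) :
    Transposition.FaceThetaSupplyWedgeExists (picardCMUniverse exists_isReal_hodgeModel_holds
      hodgePQ_independent_of_hodgeModel_holds BallQuotient.ballQuotientUniformised_holds cmAbelianVarietyRealised_holds) :=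
  faceThetaSupplyWedgeExists_of_faceSupply _ _ _ _ hW hS

/-- **`FaceThetaDataExists U_rec` from the leaf B01-H and the joint ∃-statement for the saturated theta sets** (supply S2 · item
(iii)'s `L²` dictionary · item (v)'s isolation, at one `(ι₁, V)` per face) — `faceThetaDataExists_of_saturated_items` at the
universe of record, facts and Hodge–Riemann (2,0) being the tree theorems `universeOf_fact_pull_comp/hodge`,
`universeOf_fact_cup2_hodge`, `universeOf_hodgeRiemann_pms`; compose with `Model.hc_cm_closed_of_faceThetaDataExists` for the
END-DISPLAY SHAPE `… → HC_CM`.  HC_CM is NOT proved: nobody has inhabited `h`. [folklore] -/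
theorem faceThetaDataExists_of_saturated_items (hHD : exists_isReal_hodgeModel) (hI : hodgePQ_independent_of_hodgeModel)
    (h₁ : BallQuotientUniformised) (h₃ : CMAbelianVarietyRealised) (hW : (picardCMUniverse hHD hI h₁ h₃).HeckeWedge10)
    (h : ∀ (F : CMField), IsGalois ℚ F → 6 ≤ Module.finrank ℚ F → ∀ f : Face F,
      ∃ ι₁ : F →+* ℂ, f.Admissible ι₁ ∧ ∃ (V : HermSpace3 F ι₁),
        (∃ (Γ : Level V) (ω₀ ω₁ : (picardCMUniverse hHD hI h₁ h₃).CohC ((picardCMUniverse hHD hI h₁ h₃).pms F ι₁ V Γ) 1),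
          ω₀ ∈ (picardCMUniverse hHD hI h₁ h₃).Uiso Γ F (f.psi 0) ι₁ ∧
            ω₁ ∈ (picardCMUniverse hHD hI h₁ h₃).Uiso Γ F (f.psi 1) ι₁ ∧ ω₀ ≠ 0 ∧ ω₁ ≠ 0) ∧
        ∃ (HG : Type) (_ : NormedAddCommGroup HG) (_ : InnerProductSpace ℂ HG)
          (emb : ∀ Γ : Level V, (picardCMUniverse hHD hI h₁ h₃).CohC ((picardCMUniverse hHD hI h₁ h₃).pms F ι₁ V Γ) 2 →ₗ[ℂ] HG)
          (cover : ∀ (Γ Γ' : Level V), Γ' ≤ Γ →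
            (picardCMUniverse hHD hI h₁ h₃).Mor ((picardCMUniverse hHD hI h₁ h₃).pms F ι₁ V Γ')
              ((picardCMUniverse hHD hI h₁ h₃).pms F ι₁ V Γ)),
          (∀ (Γ : Level V) (ω₁ ω₂ : (picardCMUniverse hHD hI h₁ h₃).CohC ((picardCMUniverse hHD hI h₁ h₃).pms F ι₁ V Γ) 1),
            ω₁ ∈ (picardCMUniverse hHD hI h₁ h₃).Uiso Γ F (f.psi 0) ι₁ →
            ω₂ ∈ (picardCMUniverse hHD hI h₁ h₃).Uiso Γ F (f.psi 1) ι₁ →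
            emb Γ ((picardCMUniverse hHD hI h₁ h₃).cup2C ((picardCMUniverse hHD hI h₁ h₃).pms F ι₁ V Γ) 1 ω₁ ω₂) ∈
              (Submodule.span ℂ {x : HG | ∃ (Γ' : Level V), ∃ ω₃ ∈ (picardCMUniverse hHD hI h₁ h₃).Uiso Γ' F (f.psi 2) ι₁,
                ∃ ω₄ ∈ (picardCMUniverse hHD hI h₁ h₃).Uiso Γ' F (f.psi 3) ι₁,
                x = emb Γ' ((picardCMUniverse hHD hI h₁ h₃).cup2C ((picardCMUniverse hHD hI h₁ h₃).pms F ι₁ V Γ') 1 ω₃ ω₄)}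
                ).topologicalClosure) ∧
          (∀ (Γ Γ' : Level V) (hle : Γ' ≤ Γ)
            (x : (picardCMUniverse hHD hI h₁ h₃).CohC ((picardCMUniverse hHD hI h₁ h₃).pms F ι₁ V Γ) 2),
            emb Γ' ((picardCMUniverse hHD hI h₁ h₃).pullC (cover Γ Γ' hle) 2 x) = emb Γ x) ∧
          (∀ Γ : Level V, ∃ c : ℂ, c ≠ 0 ∧
            ∀ x y : (picardCMUniverse hHD hI h₁ h₃).CohC ((picardCMUniverse hHD hI h₁ h₃).pms F ι₁ V Γ) 2,
            x ∈ ((picardCMUniverse hHD hI h₁ h₃).hodge ((picardCMUniverse hHD hI h₁ h₃).pms F ι₁ V Γ) 2).F 2 →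
            y ∈ ((picardCMUniverse hHD hI h₁ h₃).hodge ((picardCMUniverse hHD hI h₁ h₃).pms F ι₁ V Γ) 2).F 2 →
              ⟪emb Γ y, emb Γ x⟫_ℂ = c * (picardCMUniverse hHD hI h₁ h₃).trC ((picardCMUniverse hHD hI h₁ h₃).pms F ι₁ V Γ) 4
                ((picardCMUniverse hHD hI h₁ h₃).cup2C ((picardCMUniverse hHD hI h₁ h₃).pms F ι₁ V Γ) 2 x (conj y)))) :
    (picardCMUniverse hHD hI h₁ h₃).FaceThetaDataExists :=
  Transposition.faceThetaDataExists_of_saturated_items (universeOf_fact_pull_comp _ _ _ _)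
    (universeOf_fact_pull_hodge _ _ _ _) (universeOf_fact_cup2_hodge _ _ _ _) hW
    (fun Γ η hη h0 => universeOf_hodgeRiemann_pms _ _ _ _ _ Γ η hη h0) h

end Model

end Summit.HodgeConjecture.CorCM

end
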